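import Summits.QuantumFields.YangMills.Theorems.BalabanUVNodesN14L1MismatchOfBinderAndClassLawTV
import Summits.QuantumFields.YangMills.Theorems.BalabanUVNodesN20CoreEdgeShellDialStubText
import Summits.QuantumFields.YangMills.Theorems.BalabanUVNodesN14ClassLawRoadsStubTwoTextK3V5

/-!
# DAG node N14 (NE1′) — K3⁷ v5 STUB 2's REGISTERED TEXT (`K3V5Defs` names) AT THE ZERO CUT AND THE ℓ¹-OPTIMAL SHELL SPLIT FROM THE KEYED LIVE LINE, THE KEYED
# UNDRESSED CLASS-LAW TV OF RECORD AND NODE N14's KEYED BINDER — in the stub's own words, the DRESSED two-run content at these dials reduces to UNDRESSED class-law TV + NE1′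

Cell `pub-ymgap` (HUMAN RULING D-0062, Track A), WIDTH SEAT `pub-ymgap-dag-n14-w2` (NODE n14 = NE1′), generation 6, FILE 6; `--kind proof --supports
stmt-QuantumFields-20544 --as helper` (K3⁷ `SpineGivenEndpointR13SepCoPH`, skeleton v5 941dddb108cbaacf, stub 2 `stub_expansion13H`; helper, NOT a discharge; count-neutral).
THEOREMS ONLY (0 `def`, 0 `instance`, 0 `sorry`).  Imports this seat's FILE 5 `…N14L1MismatchOfBinderAndClassLawTV` (`l1Mismatch_dressed_of_undressed_noBad`, `summable_noBadBudget`;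
through it FILEs 1 ∕ 2a ∕ 2b), dag-n20-w3's 13b `…N20CoreEdgeShellDialStubText` (`exists_optShellSplit`, `pinned_relWeight_coreEdge_optShell`,
`keyedShellWeight_crOfRecord₁₃V_optShell_of_l1Mismatch`) and this seat's g5 `…N14ClassLawRoadsStubTwoTextK3V5` (`keyedExtraction_crOfRecord₁₃VAt_cutReading_of_liveLine`; through it
g2's `mgfForm_weightA₁₃ ∕ _weightB₁₃` and dag-n27-w1's mirror `K3V5Defs`) — all BY NAME; edits nothing.  (Gate note: in the route's import cone via `K3V5Defs`, as the g5 files.)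

WHAT.  dag-n20-w3's 13b gives three of stub 2's five conjuncts from NO estimate at `(jc, sh) := (0, sh⋆)` (`sh⋆` the ℓ¹-optimal shells at a constant reading `cK`) and the fourth,
`KeyedShellWeight`, from ONE keyed letter: the one-sided ℓ¹ mismatch fractions of `(weightB₁₃, e^{c_K}·weightA₁₃)` over the classes of record are `≤ w_K` on `|t| ≤ 1`, `w`
summable.  FILE 5 produces exactly that letter, at the UNDRESSED constant `c_K = log Σ weightB₁₃ K 0 − log Σ weightA₁₃ K 0`, from the UNDRESSED per-set class-law TV of record
`ρ₀`, node N14's binder `TiltedMeanMatching` on the classes of record (all of them: the zero cut has no bad class) and positivity of the undressed class totals — in the MGF form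
g2 established for `weightA₁₃ ∕ weightB₁₃` on the live-selector line (laws (H-ζ); `0 ≤ ζ` from the provisos).  Hence:
* ★★★ `stubExpansion13HText_optShell_of_liveLine_of_keyedUndressedClassLawTV_of_keyedBinder` — IF (keyed live line + (H-ζ)) and IF at every guarded admissible Stage-13 tuple
  with core provisos, for every `g₀`, `os`: node N14's binder `TiltedMeanMatching 1 (classSet₁₃ θ 0 g₀) ∅ … η` on the classes of record with `0 ≤ η`, `Σ η < ∞`, the UNDRESSED
  per-set class-law TV radius `ρ₀` with `Σ ρ₀ < ∞`, and positive undressed class totals — THEN the registered stub-2 text holds (for every `β ∈ ]2∕3, 1[` and every N16-guarded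
  reading with keyed rates — both unread), with the witness `(0, sh⋆, crOfRecord₁₃V 0 sh⋆)`.
  The fifth conjunct `KeyedExtraction` is the live line (g5 §1 ∕ dag-n20-w1's shape lemma).
LOCATED (count-neutral).  In K3⁷ v5's own words, at the zero cut and the ℓ¹-optimal shell split: stub 2 ⟸ [keyed live line + (H-ζ)] ∧ [UNDRESSED class-law TV of record, summable]
∧ [node N14 = NE1′'s binder on the classes of record, summable] — nothing about the DRESSED two-run laws beyond NE1′; compare this seat's g5 editions (node U3's class-measure
sentence on the FULL class laws at every source) and dag-n20-w5's p610536 (stub 2 false modulo law separation (LS) — the negation of the TV letter cofinally).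

HONEST FRAMING.  By-name bookkeeping on hypothesis SHAPES; the keyed live line ∕ (H-ζ), the undressed class-law TV of record and N14's binder of record are HYPOTHESES inhabited for no
tuple (K0⁷ `Record13SepCoPHInhabited` OPEN) and produced by nobody; NOT a proof of `stub_expansion13H` (its text is concluded UNDER displayed keyed hypotheses); proves NO estimate of
the programme; nothing of Bałaban's asserted; NE1′ ∕ NE7 ∕ NE7b ∕ NE7c NOT PRINTED as two-run statements for d = 4, NOT proved; N14 ∕ N19 ∕ N20 ∕ N21 ∕ N27 NOT discharged; K3⁷ OPEN,
v5 STANDS, not claimed; counts UNMOVED (typed 28∕28 · discharged 5∕28).  One finite 𝕋⁴ programme at fixed ε; R4 closes only the CONDITIONAL finite-𝕋⁴ rung `BalabanLadder.UV` — NOT ℝ⁴,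
NOT OS, NOT the Yang–Mills mass gap (Clay), which is NOT proved by any of this.
-/

set_option autoImplicit false

noncomputable section

open MeasureTheory ProbabilityTheory Finset
open scoped ENNReal BigOperators Matrix.Norms.L2Operator

namespace YMDAG.N14.StubTwoTextOfUndressedClassLawTVAndBinder

open Literature.MathematicalPhysics.QuantumFieldTheory.Balaban1983to89
open Literature.MathematicalPhysics.QuantumFieldTheory.Balaban1983to89.T4Continuum
open Literature.MathematicalPhysics.QuantumFieldTheory.Balaban1983to89.Node00
open T4ContinuumYM4Torus (ForSmallCouplings)
open Summit.QuantumFields.BalabanUV.T4Continuum.Spine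
open Summit.QuantumFields.BalabanUV.T4Continuum.NE1p.DressedMGFForm (TiltedMeanMatching)
open Summit.QuantumFields.YangMills.Theorems.K3V5Defs (SpineReading RateReadingFn RunSel LetterReading CutReading rrOfRecord KeyedRatesHolderD4 GuardedReadingN16
  KeyedRelWeight KeyedShellWeight KeyedCoreEdgeHolderD4 KeyedExtraction LiveSel PinnedAtLive)
open Summit.QuantumFields.YangMills.BalabanUVNodes.N20CoreEdgeShellDial (exists_optShellSplit pinned_relWeight_coreEdge_optShell
  keyedShellWeight_crOfRecord₁₃V_optShell_of_l1Mismatch)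
open Summit.QuantumFields.YangMills.BalabanUVNodes.N21KeyedShellWeightShellZero (zeta_nonneg_of_provisos₁₃CoPH)
open YMDAG.UVSplit hiding SU
open YMDAG.N14.AtSpineReading13CoPH
open YMDAG.N14.AtSpineReading13CoPH.V.ClassLawRoads.K3V5 (keyedExtraction_crOfRecord₁₃VAt_cutReading_of_liveLine)
open YMDAG.N14.L1MismatchOfBinderAndClassLawTV (l1Mismatch_dressed_of_undressed_noBad summable_noBadBudget)

/-- **★★★ K3⁷ v5 STUB 2's TEXT, VERBATIM, AT `(jc, sh) := (0, sh⋆)` FROM THE KEYED LIVE LINE, THE KEYED UNDRESSED CLASS-LAW TV OF RECORD AND NODE N14's KEYED BINDER.**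
IF (keyed live-selector line + (H-ζ)) and IF at every guarded admissible Stage-13 tuple with core provisos, for every `g₀`, `os`, there are `η, ρ₀ ≥ 0` summable with: node N14's
binder `TiltedMeanMatching 1 (classSet₁₃ θ 0 g₀) ∅ (prodObs ∘ A-run) (classMeasA₁₃ θ 0 g₀) (prodObs ∘ B-run) (classMeasB₁₃ θ 0 g₀) η` (all classes of record), dag-n20-w4's
per-set class-law TV for the UNDRESSED class weights of record `weightA₁₃ … K 0`, `weightB₁₃ … K 0` with radius `ρ₀ K`, and positive undressed class totals — THEN for every
`β ∈ ]2∕3, 1[` and every N16-guarded reading with keyed rates (unread) the registered conclusion holds with the witness `(0, sh⋆, crOfRecord₁₃V 0 sh⋆)`, `sh⋆` dag-n20-w3's ℓ¹-optimal shell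
split at the undressed constants `c_K = log Σ weightB₁₃ K 0 − log Σ weightA₁₃ K 0`: `PinnedAtLive` · `KeyedRelWeight` · `KeyedCoreEdgeHolderD4` (13b, no estimate) · `KeyedExtraction`
(the live line) · `KeyedShellWeight` (13b on FILE 5's `l1Mismatch_dressed_of_undressed_noBad` in g2's MGF form).  NOT a proof of `stub_expansion13H`. [bookkeeping] -/
theorem stubExpansion13HText_optShell_of_liveLine_of_keyedUndressedClassLawTV_of_keyedBinder
    (hlive : ∀ (F : T4Family) (θ : Stage13HParams F 2), θ.Provisos₁₃CoPH F 2 → (θ.ZhUnity F 2 ∧ θ.SlotsNondegenerate₁₃ F 2) → θ.Admissible F 2 →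
      LiveSel F θ ∧ ZetaMeasurable F 2 θ.ζ)
    (hN14 : ∀ (F : T4Family) (θ : Stage13HParams F 2) (hP : θ.Provisos₁₃CoPH F 2), (θ.ZhUnity F 2 ∧ θ.SlotsNondegenerate₁₃ F 2) → θ.Admissible F 2 →
      ∀ (g₀ : ℕ → ℝ) (os : List (ULoop F)), ∃ η ρ₀ : ℕ → ℝ, (∀ K, 0 ≤ η K) ∧ Summable η ∧ Summable ρ₀ ∧
        (letI : DecidableEq (Σ K, SiteSeqKey F (0 + K)) := Classical.decEq _
         TiltedMeanMatching 1 (classSet₁₃ θ 0 g₀) (fun _ _ => ∅)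
          (fun K (U : GaugeField (F.P (0 + K)) 0 (Node00.SU 2)) => T4GenFunBounds.prodObs ((datumOfRecord₁₃CoPH F 2 θ hP).scheme g₀) (0 + K) os U) (classMeasA₁₃ θ 0 g₀)
          (fun K (U : GaugeField (F.P (0 + K + 1)) 0 (Node00.SU 2)) => T4GenFunBounds.prodObs ((datumOfRecord₁₃CoPH F 2 θ hP).scheme g₀) (0 + K + 1) os U) (classMeasB₁₃ θ 0 g₀)
          η) ∧
        (∀ (K : ℕ), ∀ S ⊆ classSet₁₃ θ 0 g₀ K,
          |(∑ x ∈ S, weightA₁₃ θ hP 0 g₀ os K 0 x) / (∑ x ∈ classSet₁₃ θ 0 g₀ K, weightA₁₃ θ hP 0 g₀ os K 0 x)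
            - (∑ x ∈ S, weightB₁₃ θ hP 0 g₀ os K 0 x) / (∑ x ∈ classSet₁₃ θ 0 g₀ K, weightB₁₃ θ hP 0 g₀ os K 0 x)| ≤ ρ₀ K) ∧
        (∀ K, 0 < ∑ x ∈ classSet₁₃ θ 0 g₀ K, weightA₁₃ θ hP 0 g₀ os K 0 x) ∧
        (∀ K, 0 < ∑ x ∈ classSet₁₃ θ 0 g₀ K, weightB₁₃ θ hP 0 g₀ os K 0 x)) :
    ∀ β : ℝ, 2 / 3 < β → β < 1 →
      ∀ (𝔯 : RateReading₁₃CoPH 2) (ksel : RunSel) (ℓ : LetterReading) (ℓ₃ : T4Family → Node00.NE3Letters₁₁) (g B : T4Family → ℝ),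
        GuardedReadingN16 𝔯 ksel ℓ ℓ₃ g B → KeyedRatesHolderD4 β (rrOfRecord 𝔯 ksel) →
        ∃ (jc : CutReading) (sh : ShellSplit₁₃CoPH 2 0) (cr : SpineReading), PinnedAtLive jc sh cr ∧
          KeyedRelWeight cr ∧ KeyedShellWeight cr ∧ KeyedExtraction cr ∧ KeyedCoreEdgeHolderD4 β cr (rrOfRecord 𝔯 ksel) := by
  intro β _ _ 𝔯 ksel ℓ ℓ₃ g Bφ _ _
  -- the constant reading: the UNDRESSED log-ratio of the class totals of record; `sh⋆` dag-n20-w3's ℓ¹-optimal shells at it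
  obtain ⟨sh, hsh⟩ := exists_optShellSplit (N := 2) 0 (fun F θ hP g₀ os K =>
    Real.log (∑ x ∈ classSet₁₃ θ 0 g₀ K, weightB₁₃ θ hP 0 g₀ os K 0 x) - Real.log (∑ x ∈ classSet₁₃ θ 0 g₀ K, weightA₁₃ θ hP 0 g₀ os K 0 x))
  obtain ⟨hpin, hrel, hcore⟩ := pinned_relWeight_coreEdge_optShell sh _ β (rrOfRecord 𝔯 ksel) hsh
  refine ⟨fun _ _ _ _ _ _ => 0, sh, fun F θ hP g₀ os => crOfRecord₁₃V (fun _ => 0) sh F θ hP g₀ os, hpin, hrel, ?_, ?_, hcore⟩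
  · -- `KeyedShellWeight`: dag-n20-w3's 13b on FILE 5's no-bad-class ℓ¹ letter in g2's MGF form
    refine keyedShellWeight_crOfRecord₁₃V_optShell_of_l1Mismatch (fun _ _ _ _ _ _ => 0) sh _ hsh ?_
    intro F θ hP hG hθ g₀ os
    obtain ⟨hsel, hζm⟩ := hlive F θ hP hG hθ
    obtain ⟨η, ρ₀, hη0, hηs, hρ0s, hTM, hρ0, hZA0, hZB0⟩ := hN14 F θ hP hG hθ g₀ os
    letI : DecidableEq (Σ K, SiteSeqKey F (0 + K)) := Classical.decEq _
    have hA := mgfForm_weightA₁₃ θ 0 hP (EOfRecord₁₃ F 2 θ.toStage13Params) hsel hζm (zeta_nonneg_of_provisos₁₃CoPH F θ hP) g₀ os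
    have hB := mgfForm_weightB₁₃ θ 0 hP (EOfRecord₁₃ F 2 θ.toStage13Params) hsel hζm (zeta_nonneg_of_provisos₁₃CoPH F θ hP) g₀ os
    have hmis := fun K (t : ℝ) (ht : |t| ≤ 1) => l1Mismatch_dressed_of_undressed_noBad hA hB hTM hη0 hρ0 hZA0 hZB0 K ht
    refine ⟨_, fun K => ?_, summable_noBadBudget (B := (1 : ℝ)) zero_le_one hρ0s hηs hη0, fun K t ht => (hmis K t ht).2, fun K t ht => (hmis K t ht).1⟩
    -- the budget is nonnegative: `0 ≤ Σ (⋯)⁺ ≤ w_K · Σ weightA₁₃ K 0`, the undressed total positive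
    have h := (hmis K 0 (by rw [abs_zero]; exact zero_le_one)).2
    exact (mul_nonneg_iff_of_pos_right (hZA0 K)).mp ((Finset.sum_nonneg fun _ _ => le_max_left _ _).trans h)
  · -- `KeyedExtraction`: the keyed live line (g5 §1 ∕ dag-n20-w1's shape lemma; `crOfRecord₁₃V = crOfRecord₁₃VAt 0` is `rfl`)
    exact keyedExtraction_crOfRecord₁₃VAt_cutReading_of_liveLine (fun _ _ _ _ _ _ => 0) sh hlive

end YMDAG.N14.StubTwoTextOfUndressedClassLawTVAndBinder

end
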